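import Summits.Ventures.YMGap.Conjectures.StrongCouplingChiralLROZeroCoupling
import Literature.MathematicalPhysics.QuantumLattice.StaggeredCouplingContinuity
import HarnessLib
import HarnessLib.Audit.Tags

/-!
# Venture YMGap — Conjectures/StrongCouplingChiralLROFixedVolume.lean: chiral long-range order at small
# `β` IN EACH FIXED VOLUME — the typed conjecture `SalmhoferSeilerSmallBeta` with its quantifiers swapped

HONEST FRAMING (venture `Summits/Ventures/YMGap`, cell `pub-ymgap`, seat qcd-lit g17, `bears_on: Q1`).  The
conjecture `Summit.Ventures.YMGap.Conjectures.SalmhoferSeilerSmallBeta` (`Conjectures/StrongCouplingChiralLRO.lean`)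
asks for `β₀ > 0`, `c > 0`, `L₀` with `c ≤ ssChiralOrder N ν L β` for ALL `0 ≤ β < β₀` and ALL even
`L ≥ L₀` — one `β₀` for every volume.  It is NOT proved here and remains open (`β > 0` uniformly in `L`:
not in print).  What IS proved:

* **`continuous_ssTwoPoint_massless`**, **`continuous_ssChiralOrder`** — at fixed `N, ν, L` (even `L`,
  `ν ≥ 1`) the conjecture's objects `β ↦ ssTwoPoint N ν L β 0 x y` and `β ↦ ssChiralOrder N ν L β` are
  continuous on `ℝ` (dominated convergence for the bounded Wilson density on the compact configuration
  space `U(N)^{edges}`; the numerator integrand is Haar-integrable because it is a.e. the polynomial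
  Berezin integrand; the denominator `Z_Λ(β, 0)` is positive at every `β`);
* **`salmhoferSeiler_smallBeta_fixedVolume`** — for `1 ≤ N ≤ 4`, `ν ≥ 4` there are `c > 0` and `L₀`
  such that for every even `L ≥ L₀` THERE IS `β₀ = β₀(L) > 0` with `c ≤ ssChiralOrder N ν L β` for all
  `0 ≤ β < β₀(L)`: the `β = 0` slice `salmhoferSeiler_betaZero` (Salmhofer–Seiler Cor. 4.9) propagated to
  small `β` by continuity, volume by volume.

This is EXACTLY the conjecture with `∃ β₀` and `∀ L` interchanged; the open content of
`SalmhoferSeilerSmallBeta` is therefore isolated as the UNIFORMITY of `β₀` in the volume `L` (an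
infrared statement: rows S3∕S4 of the cell's Y3-inputs memo), nothing else.

WHAT THIS IS NOT: no `β₀` independent of `L`; no rate of continuity uniform in `L`; nothing about `SU(N)`,
Wilson fermions, the continuum, `IsChiralAtZero`, a mass gap, or the Clay problem.  Theorems only; no
facts, no `sorry`.

Reference: M. Salmhofer, E. Seiler, Commun. Math. Phys. 139 (1991) 395–432, §2 (2.2), (2.9)–(2.12),
Cor. 4.9 [SalmhoferSeiler1991].
-/

noncomputable section

namespace Summit.Ventures.YMGap.Conjectures

open MeasureTheory Finset
open Literature.MathematicalPhysics.QuantumLattice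
open Literature.Probability.LatticeModels (TorusSite)

/-- **Continuity in `β` of the conjecture's massless two-point function** at fixed volume (even `L`,
`ν ≥ 1`). [cite: SalmhoferSeiler1991, §2 (2.2), (2.9)–(2.12)] -/
theorem continuous_ssTwoPoint_massless (N ν L : ℕ) [NeZero ν] [NeZero L] (hL : Even L) (x y : TorusSite ν L) :
    Continuous fun β : ℝ => ssTwoPoint N ν L β 0 x y := by
  exact StaggeredRP.continuous_detRep_twoPoint (N := N) hL x y

/-- **Continuity in `β` of the conjecture's chiral order parameter** `ssChiralOrder N ν L` at fixed volume
(even `L`, `ν ≥ 1`). [cite: SalmhoferSeiler1991, §2 (2.2), (2.9)–(2.12)] -/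
theorem continuous_ssChiralOrder (N ν L : ℕ) [NeZero ν] [NeZero L] (hL : Even L) :
    Continuous (ssChiralOrder N ν L) := by
  unfold ssChiralOrder
  exact continuous_const.mul (continuous_finsetSum _ fun x _ => continuous_ssTwoPoint_massless N ν L hL 0 x)

/-- **Chiral long-range order at small `β`, volume by volume** (`1 ≤ N ≤ 4`, `ν ≥ 4`): there are `c > 0`
and `L₀` such that for every even `L ≥ L₀` there is `β₀(L) > 0` with `c ≤ ssChiralOrder N ν L β` for
all `0 ≤ β < β₀(L)` — the typed conjecture `SalmhoferSeilerSmallBeta` with `∃ β₀` and `∀ L` swapped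
(Cor. 4.9 at `β = 0` plus continuity in `β` at fixed volume; the uniformity of `β₀` in `L` is the open
conjecture and is NOT claimed). [cite: SalmhoferSeiler1991, Cor. 4.9 with §2 (2.9)–(2.12)] -/
theorem salmhoferSeiler_smallBeta_fixedVolume :
    ∀ N ν : ℕ, 1 ≤ N → N ≤ 4 → 4 ≤ ν →
      ∃ c : ℝ, 0 < c ∧ ∃ L₀ : ℕ, ∀ (L : ℕ) [NeZero L], Even L → L₀ ≤ L →
        ∃ β₀ : ℝ, 0 < β₀ ∧ ∀ β : ℝ, 0 ≤ β → β < β₀ → c ≤ ssChiralOrder N ν L β := by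
  intro N ν hN1 hN4 hν
  obtain ⟨c, hc, L₀, h⟩ := salmhoferSeiler_betaZero N ν hN1 hN4 hν
  refine ⟨c / 2, half_pos hc, L₀, fun L _ hE hL => ?_⟩
  haveI : NeZero ν := ⟨by omega⟩
  have h0 : c ≤ ssChiralOrder N ν L 0 := h L hE hL
  have hopen : IsOpen (ssChiralOrder N ν L ⁻¹' Set.Ioi (c / 2)) :=
    (continuous_ssChiralOrder N ν L hE).isOpen_preimage _ isOpen_Ioi
  have hmem : (0 : ℝ) ∈ ssChiralOrder N ν L ⁻¹' Set.Ioi (c / 2) := by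
    rw [Set.mem_preimage, Set.mem_Ioi]
    linarith
  obtain ⟨ε, hε, hball⟩ := Metric.isOpen_iff.1 hopen 0 hmem
  refine ⟨ε, hε, fun β hβ0 hβ => ?_⟩
  have hβball : β ∈ Metric.ball (0 : ℝ) ε := by
    rw [Metric.mem_ball, Real.dist_eq, sub_zero, abs_of_nonneg hβ0]
    exact hβ
  exact le_of_lt (hball hβball)

end Summit.Ventures.YMGap.Conjectures

end
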